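import Summits.HodgeConjecture.HodgeConjecture.Theses.GenericDivisibility
import Summits.HodgeConjecture.HodgeConjecture.Theorems.GenericDivisibilityHodgeModelsExist
import Summits.HodgeConjecture.HodgeConjecture.Theorems.GenericDivisibilityHodgeClassesGenericallyDivisibleFinite
import Literature.AlgebraicGeometry.Motives.VarietiesUnitProofs
import Literature.AlgebraicGeometry.Motives.SmoothHypersurfaceExistenceProofs
import Literature.AlgebraicGeometry.Motives.ClosedGraphMorphism
import Literature.AlgebraicGeometry.HodgeTheory.SupportedClassesHodgeConiveauHolds
import Literature.AlgebraicGeometry.HodgeTheory.SupportedClassesRationalProofs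
import Literature.AlgebraicGeometry.HodgeTheory.RationalLatticeIntegral
import Literature.AlgebraicGeometry.HodgeTheory.IntegralClassesCountable
import Literature.AlgebraicGeometry.HodgeTheory.HypersurfaceHodgeFiltrationProofs
import Literature.AlgebraicGeometry.HodgeTheory.HodgeFiltrationModels
import Literature.AlgebraicGeometry.HodgeTheory.ComplexConjugationHolds
import Literature.AlgebraicTopology.SingularHomology.CohomologyOfPoint
import Literature.AlgebraicTopology.SingularHomology.CupProduct

/-!
# Disproof of `HodgeClassesGenericallyDivisible` (C1, item stmt-HodgeConjecture-18466) — findings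

Work file of the standing crux disprover (refuter-cdisprove-stmt-HodgeConjecture-18466-0, cycle 1,
2026-08-17).  Everything below is sorry-free and farm-checked; prose lives in docstrings only.
The crux (route `GenericDivisibility`, rank 2): for `p ≥ 1`, `X/ℂ` smooth projective of dimension
`2p`, `z ∈ H²ᵖ(X(ℂ); ℤ)` with `z ⊗ 1` of Hodge type `(p,p)`, and every `m ≥ 1`, there is a
Zariski-closed `Z ≠ X` and `y ∈ H²ᵖ((X∖Z)(ℂ); ℤ)` with `m • y = z|`.

## Verdict of cycle 1: NO KILL — the crux is target-implied (summit-strength), not misstated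

* CEILING (`not_hodgeConjecture_of_not_crux`, from the provers' landed
  `hodgeClassesGenericallyDivisible_of_hodgeConjecture_of_facts`): Dimca 1992 ∧ CT–Voisin 2012
  Thm 3.1 ∧ HC ⟹ C1, so `¬ C1` is a counterexample to the Hodge conjecture seen with finite
  coefficients.  Every catalogued non-algebraic INTEGRAL Hodge class (Atiyah–Hirzebruch, Kollár,
  Totaro, Benoist–Ottem, Ottem–Suzuki arXiv:1906.08994, Engel–de Gaay Fortman–Schreieder
  arXiv:2507.15704, the 2026 Bockstein families arXiv:2605.02129) is torsion or has an algebraic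
  multiple, hence is torsion on a non-empty open and dies on a smaller one (landed
  `hodgeClassesGenericallyDivisible_of_divisibleModTorsion`): none is a `¬ C1` witness.  S2 search
  2026-08-17 ("coniveau integral Hodge classes", 19 hits, 2016–2026): nothing else; OpenAlex 429,
  local searchd reset (degraded, recorded).
* FAITHFULNESS: the formal statement was read symbol by symbol (analytic topology on `X(ℂ)` =
  `AlgPoints.instTopologicalSpace`; `Z : Set X.left` Zariski-closed; `(X∖Z)(ℂ)` = subtype
  `P.pt ∉ Z`; `IsOfHodgeType` = `∃` over Hodge models, safe direction; `ℕ`-smul on a `ℤ`-module).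
  No junk operator, no vacuity: the only degenerate instances are `p = 0` (excluded by `1 ≤ p`,
  and genuinely false there, §(a)) and `Z = univ` (excluded, and the statement is trivial without
  the guard, §(a)).  Geometric irreducibility makes "some non-empty open" = "generically".

## (a) Load-bearing analysis (one `def …Without…` + theorem per hypothesis)

* `1 ≤ p`: LOAD-BEARING — `crux_false_without_hp` (p = 0, `X = Spec ℂ`, `z = 1`, `m = 2`).
  Landed: `Theorems/HodgeClassesGenericallyDivisible/Negative/LoadBearing.lean` (p144814).
* `IsOfHodgeType … p p (z ⊗ 1)`: LOAD-BEARING GRANTED C2 — `crux_false_without_hodgeType_of_bounded :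
  GenericDivisibilityBounded → ¬ CruxWithoutHodgeType`, via the unconditional
  `not_forall_integral_middle_class_coniveau_one` (a smooth quartic surface carries a non-zero
  `(0,2)`-class; integral classes span `H²`; Grothendieck/Deligne: `N¹ ∩ H^{0,2} = 0`).  So
  `¬ (C1-without-Hodge-type ∧ C2)` outright; on paper C1-without-Hodge-type is false already at
  `p = 1` on every surface with `p_g > 0` (Kummer: `N¹H²(S; ℤ/m) = NS(S)/m`), but the tree has no
  computed `N¹H²(S; ℤ/m)`, so the C2-relative form is what is checkable.  Landed:
  `…/Negative/HodgeType.lean` (proposal id in NOTES).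
* `1 ≤ m`: NOT load-bearing for truth — `cruxWithoutHm_iff_genericallyZero`: dropping it adds the
  instance `m = 0`, i.e. generic vanishing `z| = 0`, which is HC-implied
  (`genericDivisibility_exists_restrict_eq_zero_of_hodgeConjectureFor`) and implies the crux
  (`crux_of_genericallyZero`).  No `_false_without_hm` exists unless HC fails.
* `Z ≠ Set.univ`: the only content guard — `cruxWithoutNeUniv_trivial` (junk `Z = X`, `U(ℂ) = ∅`).
* `IsClosed Z`: the second guard — `cruxWithoutIsClosed_trivial` (junk `Z = X ∖ {P₀.pt}` for a
  complex point `P₀`: `U(ℂ) = {P₀}` by `AlgPoints.eq_of_pt_eq`, `H²ᵖ(pt; ℤ) = 0`).  Landed: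
  `…/Negative/ClosedGuard.lean` (proposal id in NOTES).
* `IsSmoothProjective`: irreducibility is used only to intersect opens (it makes the statement
  WEAKER, never false); projectivity enters through the Hodge type only.  Not attackable on the
  tree's carriers (no non-algebraic compact Kähler `X(ℂ)` has Zariski opens).

## (b) Tightness / boundary

* `m = 1` is free (`crux_at_modulus_one`: `Z = ∅`, `y = z|`); `p = 1` is the integral Lefschetz
  `(1,1)` theorem (provers' `hodgeClassesGenericallyDivisible_one_of_facts`); first open rung
  `p = 2` = HC(2,2) for fourfolds with `h^{4,0} + h^{3,1} > 0` (census §0).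
* Uniformity of `Z` in `z` is free (finite generation of `H²ᵖ(X(ℂ); ℤ)` + union of closed sets);
  uniformity in `m` (one `Z` for all `m`) is HC-middle itself (census S⁺₂) — not refutable.

## (c) Natural strengthenings refuted

* "every INTEGRAL middle class has coniveau ≥ 1" (Hodge type dropped from the census's
  `MiddleIntegralHodgeConiveauOne` / S⁺₁): FALSE — `not_forall_integral_middle_class_coniveau_one`.
* "every integral middle class is generically `m`-divisible for all `m`" ∧ C2: FALSE (same theorem).
* Global divisibility (`Z = ∅` forced) is false (hyperplane class on `ℙ²`, `m = 2`) — not typed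
  (needs `H²(ℙ²(ℂ); ℤ) = ℤ·h` on the tree's carriers; low value).

## (d) Targets (lead's stuck stubs): none yet — no line registered (`PICKED.md` absent).
## (e) Near-misses: none.  WHY IT RESISTS: every honest attack on C1 must produce, for a
transcendental-looking `(p,p)` class, a divisor carrying `z mod m` — the existence half of HC in the
middle degree with an `ℓʳ`-congruence relaxation that has no existence mechanism of its own
(census D3); conversely a refutation needs a Hodge class with non-zero Galois symbol in
`K^M_{2p}(ℂ(X))/m`, and the only detector in print (Bloch–Esnault `d log`) vanishes on absolute
Hodge classes.  Both directions are the summit.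
-/

set_option linter.dupNamespace false

noncomputable section

namespace Summit.HodgeConjecture.HodgeConjecture.Cruxes.HodgeClassesGenericallyDivisible.Disproof

open CategoryTheory AlgebraicGeometry MonoidalCategory CartesianMonoidalCategory
open Literature.AlgebraicGeometry.Motives Literature.AlgebraicGeometry.HodgeTheory
  Literature.AlgebraicTopology.SingularHomology
open Summit.HodgeConjecture.HodgeConjecture.Theses.GenericDivisibility
open Summit.HodgeConjecture.HodgeConjecture.Theorems

/-! ## Ceiling: `¬ C1 → ¬ HC` -/

/-- **`¬ C1 → ¬ HodgeConjecture`** granted the two printed theorems Dimca 1992 Cor. (6.10) and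
Colliot-Thélène–Voisin 2012 Thm 3.1 (contrapositive of the provers'
`hodgeClassesGenericallyDivisible_of_hodgeConjecture_of_facts`). [cite: ColliotTheleneVoisin2012, Thm 3.1] -/
theorem not_hodgeConjecture_of_not_crux
    (hfin : Dimca1992_finite_singularHomology_complexPointsCompl)
    (hT : ColliotTheleneVoisin2012_torsionDiesGenerically)
    (h : ¬ HodgeClassesGenericallyDivisible) : ¬ _root_.HodgeConjecture :=
  fun hHC ↦ h (hodgeClassesGenericallyDivisible_of_hodgeConjecture_of_facts hfin hT hHC)

/-! ## (a) Hypothesis `1 ≤ p` — load-bearing -/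

/-- C1 with the hypothesis `1 ≤ p` deleted (so the point `p = 0`, `X = Spec ℂ` is allowed). -/
def CruxWithoutHp : Prop :=
  ∀ ⦃p : ℕ⦄ ⦃X : SchemeOver ℂ⦄, IsSmoothProjective (2 * p) X →
    ∀ z : singularCohomology ℤ ℤ (ComplexPoints X) (2 * p),
      IsOfHodgeType (2 * p) X (2 * p) p p
        (singularCohomology.ringChange (Int.castRingHom ℂ) (ComplexPoints X) (2 * p) z) →
      ∀ m : ℕ, 1 ≤ m → ∃ Z : Set X.left, IsClosed Z ∧ Z ≠ Set.univ ∧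
        ∃ y : singularCohomology ℤ ℤ (complexPointsCompl X Z) (2 * p),
          m • y = singularCohomology.map ℤ ℤ
            (⟨Subtype.val, continuous_subtype_val⟩ : C(complexPointsCompl X Z, ComplexPoints X))
            (2 * p) z

/-- Sanity: the weakened-hypothesis statement implies the crux (it only deletes a binder). -/
theorem crux_of_withoutHp (h : CruxWithoutHp) : HodgeClassesGenericallyDivisible :=
  fun _ _ _ hX ↦ h hX

/-- In degree `0` every class is of Hodge type `(0,0)` in any Hodge model (the Hodge
decomposition field at `k = 0` has the single summand `H^{0,0}`). [cite: VoisinHodgeI2002, §6.1] -/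
theorem isOfHodgeType_deg_zero {n : ℕ} {X : SchemeOver ℂ} (A : HodgeModel n X)
    (c : singularCohomology ℂ ℂ (ComplexPoints X) 0) : IsOfHodgeType n X 0 0 0 c := by
  refine ⟨A, ?_⟩
  have htop : Literature.NumberTheory.Transcendental.hodgePQ A.model A.carrier 0 0 0 = ⊤ := by
    have h := (A.isInternal_hodgePQ 0).submodule_iSup_eq_top
    refine eq_top_iff.2 (h ▸ iSup_le fun i ↦ ?_)
    obtain ⟨⟨a, b⟩, hab⟩ := i
    have hab' : a + b = 0 := Finset.HasAntidiagonal.mem_antidiagonal.1 hab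
    obtain ⟨rfl, rfl⟩ : a = 0 ∧ b = 0 := ⟨by omega, by omega⟩
    exact le_rfl
  have hA : A.hodgePQ 0 0 0 = ⊤ := by
    rw [HodgeModel.hodgePQ, htop, Submodule.map_top]
    exact LinearEquiv.range (A.deRham A.carrier 0)
  rw [hA]
  exact Submodule.mem_top

/-- `ε(1) = 1` for the evaluation `ε : H⁰(U; ℤ) ≃ ℤ` of a path-connected space. [cite: HatcherAT2002, §3.1 p. 199] -/
theorem zeroEquiv_one {U : Type} [TopologicalSpace U] [PathConnectedSpace U] :
    singularCohomologyZeroEquiv ℤ ℤ U (singularCohomology.one ℤ U) = 1 := by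
  rw [singularCohomology.one, singularCohomologyZeroEquiv_π,
    singularCochainComplex.cocyclesZeroEquiv_apply, singularCochainComplex.iCocycles_mk]
  rfl

/-- **Any proof of C1 must use `1 ≤ p`.** Witness: `p = 0`, `X = Spec ℂ = 𝟙_ (SchemeOver ℂ)`,
`z = 1 ∈ H⁰(X(ℂ); ℤ) = ℤ` (of type `(0,0)`), `m = 2`: `Spec ℂ` has one point, so `Z ≠ univ` keeps
the unique complex point in `(X ∖ Z)(ℂ)`, a one-point space with `H⁰ = ℤ · 1`, and `2 • y = 1`
has no solution. (Landed verbatim, inline form, in `…/Negative/LoadBearing.lean`.)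
[cite: HatcherAT2002, §3.1 p. 199] -/
theorem crux_false_without_hp : ¬ CruxWithoutHp := by
  intro h
  have hX : IsSmoothProjective (2 * 0) (𝟙_ (SchemeOver ℂ)) := isSmoothProjective_unit_holds ℂ
  obtain ⟨A⟩ := genericDivisibility_hodgeModelsExist_proof (2 * 0) _ hX
  have hz : IsOfHodgeType (2 * 0) (𝟙_ (SchemeOver ℂ)) (2 * 0) 0 0
      (singularCohomology.ringChange (Int.castRingHom ℂ) (ComplexPoints (𝟙_ (SchemeOver ℂ)))
        (2 * 0) (singularCohomology.one ℤ (ComplexPoints (𝟙_ (SchemeOver ℂ))))) :=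
    isOfHodgeType_deg_zero A _
  obtain ⟨Z, -, hZ, y, hy⟩ :=
    h hX (singularCohomology.one ℤ (ComplexPoints (𝟙_ (SchemeOver ℂ)))) hz 2 (by norm_num)
  haveI : Subsingleton ↥((𝟙_ (SchemeOver ℂ)).left) :=
    inferInstanceAs (Subsingleton (PrimeSpectrum ℂ))
  let P₀ : ComplexPoints (𝟙_ (SchemeOver ℂ)) := toUnit _
  have hP₀ : P₀.pt ∉ Z := fun hP ↦
    hZ (Set.eq_univ_of_forall fun x ↦ (Subsingleton.elim P₀.pt x) ▸ hP)
  haveI : PathConnectedSpace (complexPointsCompl (𝟙_ (SchemeOver ℂ)) Z) :=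
    ⟨⟨⟨P₀, hP₀⟩⟩, fun x y ↦ by rw [Subsingleton.elim x y]⟩
  have key := congrArg (singularCohomologyZeroEquiv ℤ ℤ (complexPointsCompl (𝟙_ (SchemeOver ℂ)) Z)) hy
  have h1 : singularCohomology.map ℤ ℤ
      (⟨Subtype.val, continuous_subtype_val⟩ :
        C(complexPointsCompl (𝟙_ (SchemeOver ℂ)) Z, ComplexPoints (𝟙_ (SchemeOver ℂ)))) 0
      (singularCohomology.one ℤ (ComplexPoints (𝟙_ (SchemeOver ℂ)))) =
      singularCohomology.one ℤ _ := singularCohomology.map_one _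
  have h2 : singularCohomologyZeroEquiv ℤ ℤ (complexPointsCompl (𝟙_ (SchemeOver ℂ)) Z)
      (singularCohomology.map ℤ ℤ
        (⟨Subtype.val, continuous_subtype_val⟩ :
          C(complexPointsCompl (𝟙_ (SchemeOver ℂ)) Z, ComplexPoints (𝟙_ (SchemeOver ℂ)))) (2 * 0)
        (singularCohomology.one ℤ (ComplexPoints (𝟙_ (SchemeOver ℂ))))) = 1 :=
    (congrArg _ h1).trans zeroEquiv_one
  rw [map_nsmul, h2, nsmul_eq_mul, Nat.cast_ofNat] at key
  omega

/-! ## (a) Hypothesis `IsOfHodgeType` — load-bearing granted C2; and an unconditional negative -/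

/-- A smooth projective surface with a non-zero class of type `(0,2)`: a smooth quartic
`Y ⊂ ℙ³_ℂ`. [cite: VoisinHodgeII2003, §6.1.3 and Cor. 6.12] [cite: Hartshorne1977, II Example 8.20.2] -/
theorem exists_surface_class_zero_two_ne_zero :
    ∃ Y : SchemeOver ℂ, IsSmoothProjective 2 Y ∧
      ∃ c : complexBetti Y 2, IsOfHodgeType 2 Y 2 0 2 c ∧ c ≠ 0 := by
  obtain ⟨Y, hY⟩ :=
    exists_isSmoothHypersurface_holds.{0}.complex (n := 2) (d := 4) (by norm_num) (by norm_num)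
  obtain ⟨A⟩ := nonempty_hodgeModel_holds hY.1
  have hne : A.hodgePQ 2 0 2 ≠ ⊥ :=
    Voisin2003_hypersurface_hodgePQ_zero_ne_bot_holds 2 4 (by norm_num) (by norm_num) Y hY A
  obtain ⟨w, hw, hw0⟩ := (Submodule.ne_bot_iff _).1 hne
  obtain ⟨c, hc⟩ := A.pullback_surjective 2 w
  refine ⟨Y, hY.1, c, ⟨A, by rw [hc]; exact hw⟩, fun h0 ↦ hw0 ?_⟩
  rw [← hc, h0, map_zero]

/-- **REFUTED STRENGTHENING (unconditional): not every integral middle-degree class has coniveau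
`≥ 1`.** The census's generic-vanishing statement with the Hodge type dropped is false: on the
quartic surface, integral classes span `H²(Y(ℂ); ℂ)` (`span_isRationalClass_eq_top_…_holds` +
`IsRationalClass.exists_nsmul_isIntegralClass`), so it would give `N¹H² = H²`, while a non-zero
`(0,2)`-class is never supported in codimension `≥ 1` (`Grothendieck1969_supportedClasses_le_hodgeConiveau_holds`,
from Deligne's Cor. 8.2.8). [cite: GrothendieckTopology1969, p. 300] [cite: DeligneHodgeIII1974, Cor. 8.2.8] -/
theorem not_forall_integral_middle_class_coniveau_one :
    ¬ (∀ ⦃p : ℕ⦄ ⦃X : SchemeOver ℂ⦄, 1 ≤ p → IsSmoothProjective (2 * p) X →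
        ∀ z : singularCohomology ℤ ℤ (ComplexPoints X) (2 * p),
          singularCohomology.ringChange (Int.castRingHom ℂ) (ComplexPoints X) (2 * p) z ∈
            supportedClasses X (2 * p) 1) := by
  intro h
  obtain ⟨Y, hY, c, hc, hc0⟩ := exists_surface_class_zero_two_ne_zero
  have h1 : ∀ z : singularCohomology ℤ ℤ (ComplexPoints Y) 2,
      singularCohomology.ringChange (Int.castRingHom ℂ) (ComplexPoints Y) 2 z ∈
        supportedClasses Y 2 1 :=
    fun z ↦ h (p := 1) le_rfl hY z
  have htop : supportedClasses Y 2 1 = ⊤ := by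
    refine eq_top_iff.2 ?_
    rw [← span_isRationalClass_eq_top_of_isSmoothProjective_holds 2 Y hY 2]
    refine Submodule.span_le.2 fun a ha ↦ ?_
    obtain ⟨N, hN, hNa⟩ := IsRationalClass.exists_nsmul_isIntegralClass hY ha
    obtain ⟨z, hz⟩ := (isIntegralClass_iff_mem_range_ringChange _).1 hNa
    have hmem : (N : ℂ) • a ∈ supportedClasses Y 2 1 := hz ▸ h1 z
    have hNa' : a = (N : ℂ)⁻¹ • ((N : ℂ) • a) := by
      rw [smul_smul, inv_mul_cancel₀ (by exact_mod_cast hN.ne'), one_smul]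
    rw [SetLike.mem_coe, hNa']
    exact Submodule.smul_mem _ _ hmem
  exact hc0 (Grothendieck1969_supportedClasses_le_hodgeConiveau_holds.eq_zero_of_isOfHodgeType hY
    (show 0 + 2 = 2 from rfl) (Or.inl Nat.one_pos) (htop ▸ Submodule.mem_top) hc)

/-- C1 with the Hodge-type hypothesis `IsOfHodgeType (2p) X (2p) p p (z ⊗ 1)` deleted. -/
def CruxWithoutHodgeType : Prop :=
  ∀ ⦃p : ℕ⦄ ⦃X : SchemeOver ℂ⦄, 1 ≤ p → IsSmoothProjective (2 * p) X →
    ∀ z : singularCohomology ℤ ℤ (ComplexPoints X) (2 * p),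
      ∀ m : ℕ, 1 ≤ m → ∃ Z : Set X.left, IsClosed Z ∧ Z ≠ Set.univ ∧
        ∃ y : singularCohomology ℤ ℤ (complexPointsCompl X Z) (2 * p),
          m • y = singularCohomology.map ℤ ℤ
            (⟨Subtype.val, continuous_subtype_val⟩ : C(complexPointsCompl X Z, ComplexPoints X))
            (2 * p) z

/-- Sanity: the Hodge-type-free statement implies the crux. -/
theorem crux_of_withoutHodgeType (h : CruxWithoutHodgeType) : HodgeClassesGenericallyDivisible :=
  fun _ _ hp hX z _ ↦ h hp hX z

/-- **Granted the route's Hodge-free crux C2, any proof of C1 must use the Hodge type of `z`**: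
`GenericDivisibilityBounded → ¬ CruxWithoutHodgeType` — C1-without-Hodge-type feeds every integral
middle class into C2, which returns coniveau `≥ 1` for all of them, contradicting
`not_forall_integral_middle_class_coniveau_one`.  Equivalently `¬ (CruxWithoutHodgeType ∧ C2)`
unconditionally.  (Landed, inline form, in `…/Negative/HodgeType.lean`.)
[cite: GrothendieckTopology1969, p. 300] [cite: VoisinHodgeI2002, Thm. 11.30] -/
theorem crux_false_without_hodgeType_of_bounded (h2 : GenericDivisibilityBounded) :
    ¬ CruxWithoutHodgeType := fun h ↦
  not_forall_integral_middle_class_coniveau_one fun _ _ hp hX z ↦ h2 hp hX z (h hp hX z)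

/-! ## (a) Hypothesis `1 ≤ m` — NOT load-bearing for truth -/

/-- C1 with the hypothesis `1 ≤ m` deleted (so `m = 0` is allowed). -/
def CruxWithoutHm : Prop :=
  ∀ ⦃p : ℕ⦄ ⦃X : SchemeOver ℂ⦄, 1 ≤ p → IsSmoothProjective (2 * p) X →
    ∀ z : singularCohomology ℤ ℤ (ComplexPoints X) (2 * p),
      IsOfHodgeType (2 * p) X (2 * p) p p
        (singularCohomology.ringChange (Int.castRingHom ℂ) (ComplexPoints X) (2 * p) z) →
      ∀ m : ℕ, ∃ Z : Set X.left, IsClosed Z ∧ Z ≠ Set.univ ∧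
        ∃ y : singularCohomology ℤ ℤ (complexPointsCompl X Z) (2 * p),
          m • y = singularCohomology.map ℤ ℤ
            (⟨Subtype.val, continuous_subtype_val⟩ : C(complexPointsCompl X Z, ComplexPoints X))
            (2 * p) z

/-- **Generic vanishing** (census S⁺₁ with `N = 1`): every integral middle-degree class with
`(p,p)` complexification dies integrally on the complex points of some non-empty Zariski open.
HC-implied (`genericDivisibility_exists_restrict_eq_zero_of_hodgeConjectureFor`). -/
def GenericallyZero : Prop :=
  ∀ ⦃p : ℕ⦄ ⦃X : SchemeOver ℂ⦄, 1 ≤ p → IsSmoothProjective (2 * p) X →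
    ∀ z : singularCohomology ℤ ℤ (ComplexPoints X) (2 * p),
      IsOfHodgeType (2 * p) X (2 * p) p p
        (singularCohomology.ringChange (Int.castRingHom ℂ) (ComplexPoints X) (2 * p) z) →
      ∃ Z : Set X.left, IsClosed Z ∧ Z ≠ Set.univ ∧
        singularCohomology.map ℤ ℤ
          (⟨Subtype.val, continuous_subtype_val⟩ : C(complexPointsCompl X Z, ComplexPoints X))
          (2 * p) z = 0

/-- **Dropping `1 ≤ m` gives exactly generic vanishing** (the instance `m = 0` reads `0 = z|`;
conversely `z| = 0 = m • 0`).  Since generic vanishing is HC-implied, `1 ≤ m` is not load-bearing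
for TRUTH — it only keeps C1 weaker than HC-middle. [cite: ColliotTheleneVoisin2012, Thm 3.1] -/
theorem cruxWithoutHm_iff_genericallyZero : CruxWithoutHm ↔ GenericallyZero := by
  constructor
  · intro h p X hp hX z hz
    obtain ⟨Z, hZc, hZne, y, hy⟩ := h hp hX z hz 0
    exact ⟨Z, hZc, hZne, by rw [← hy, zero_smul]⟩
  · intro h p X hp hX z hz m
    obtain ⟨Z, hZc, hZne, h0⟩ := h hp hX z hz
    exact ⟨Z, hZc, hZne, 0, by rw [smul_zero, h0]⟩

/-- Generic vanishing implies the crux (witness `y = 0`, uniformly in `m`). -/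
theorem crux_of_genericallyZero (h : GenericallyZero) : HodgeClassesGenericallyDivisible := by
  intro p X hp hX z hz m _
  obtain ⟨Z, hZc, hZne, h0⟩ := h hp hX z hz
  exact ⟨Z, hZc, hZne, 0, by rw [smul_zero, h0]⟩

/-! ## (a) Guard `Z ≠ Set.univ` — the only content guard -/

/-- C1 with the guard `Z ≠ Set.univ` deleted. -/
def CruxWithoutNeUniv : Prop :=
  ∀ ⦃p : ℕ⦄ ⦃X : SchemeOver ℂ⦄, 1 ≤ p → IsSmoothProjective (2 * p) X →
    ∀ z : singularCohomology ℤ ℤ (ComplexPoints X) (2 * p),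
      IsOfHodgeType (2 * p) X (2 * p) p p
        (singularCohomology.ringChange (Int.castRingHom ℂ) (ComplexPoints X) (2 * p) z) →
      ∀ m : ℕ, 1 ≤ m → ∃ Z : Set X.left, IsClosed Z ∧
        ∃ y : singularCohomology ℤ ℤ (complexPointsCompl X Z) (2 * p),
          m • y = singularCohomology.map ℤ ℤ
            (⟨Subtype.val, continuous_subtype_val⟩ : C(complexPointsCompl X Z, ComplexPoints X))
            (2 * p) z

/-- **Without the guard `Z ≠ univ`, C1 is trivially true** (junk `Z = X`, `U(ℂ) = ∅`,
`H²ᵖ(∅; ℤ) = 0`, `y = 0`; no hypothesis used). [cite: HatcherAT2002, §3.1] -/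
theorem cruxWithoutNeUniv_trivial : CruxWithoutNeUniv := by
  intro p X _ _ z _ m _
  refine ⟨Set.univ, isClosed_univ, 0, ?_⟩
  haveI : IsEmpty (complexPointsCompl X Set.univ) := ⟨fun P ↦ P.2 (Set.mem_univ _)⟩
  haveI := ModuleCat.subsingleton_of_isZero
    (isZero_singularCohomology_of_isEmpty ℤ ℤ (E := complexPointsCompl X Set.univ) (2 * p))
  exact Subsingleton.elim _ _

/-! ## (a) Guard `IsClosed Z` — the second content guard -/

/-- A smooth projective complex variety has a complex point (non-empty + Jacobson +
Nullstellensatz). [cite: Hartshorne1977, II Ex. 2.14 and I.1] -/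
theorem nonempty_complexPoints {n : ℕ} {X : SchemeOver ℂ} (hX : IsSmoothProjective n X) :
    Nonempty (ComplexPoints X) := by
  haveI := hX.smoothOfRelativeDimension
  haveI : Smooth X.hom := SmoothOfRelativeDimension.smooth n X.hom
  haveI := hX.geometricallyIrreducible
  haveI : IrreducibleSpace X.left :=
    AlgebraicGeometry.GeometricallyIrreducible.irreducibleSpace_of_subsingleton X.hom
  haveI : JacobsonSpace X.left := LocallyOfFiniteType.jacobsonSpace X.hom
  have h : (Set.univ ∩ closedPoints X.left).Nonempty := by
    by_contra h
    rw [Set.not_nonempty_iff_eq_empty] at h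
    have h2 := JacobsonSpace.closure_inter_closedPoints_eq_closure
      (isClosed_univ (X := X.left)).isLocallyClosed
    rw [h, closure_empty, closure_univ] at h2
    exact Set.empty_ne_univ h2
  obtain ⟨x, -, hxcl⟩ := h
  obtain ⟨z, -⟩ := AlgPoints.exists_pt_eq_of_isClosed_singleton (X := X) (K := ℂ)
    (mem_closedPoints_iff.mp hxcl)
  exact ⟨z⟩

/-- C1 with the requirement `IsClosed Z` deleted. -/
def CruxWithoutIsClosed : Prop :=
  ∀ ⦃p : ℕ⦄ ⦃X : SchemeOver ℂ⦄, 1 ≤ p → IsSmoothProjective (2 * p) X →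
    ∀ z : singularCohomology ℤ ℤ (ComplexPoints X) (2 * p),
      IsOfHodgeType (2 * p) X (2 * p) p p
        (singularCohomology.ringChange (Int.castRingHom ℂ) (ComplexPoints X) (2 * p) z) →
      ∀ m : ℕ, 1 ≤ m → ∃ Z : Set X.left, Z ≠ Set.univ ∧
        ∃ y : singularCohomology ℤ ℤ (complexPointsCompl X Z) (2 * p),
          m • y = singularCohomology.map ℤ ℤ
            (⟨Subtype.val, continuous_subtype_val⟩ : C(complexPointsCompl X Z, ComplexPoints X))
            (2 * p) z

/-- **Without `IsClosed Z`, C1 is trivially true** (junk `Z = X ∖ {P₀.pt}`: the complex points off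
`Z` are those over the closed point `P₀.pt`, i.e. `P₀` alone by `AlgPoints.eq_of_pt_eq`, and
`H²ᵖ(pt; ℤ) = 0` for `p ≥ 1`; no hypothesis on `z` used).  With `…WithoutNeUniv` this shows both
guards of the conclusion are needed and neither can be weakened. (Landed, inline form, in
`…/Negative/ClosedGuard.lean`.) [cite: HatcherAT2002, §3.1 p. 199] -/
theorem cruxWithoutIsClosed_trivial : CruxWithoutIsClosed := by
  intro p X hp hX z _ m _
  obtain ⟨P₀⟩ := nonempty_complexPoints hX
  haveI := hX.smoothOfRelativeDimension
  haveI : Smooth X.hom := SmoothOfRelativeDimension.smooth (2 * p) X.hom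
  refine ⟨{x | x ≠ P₀.pt}, fun h ↦ ?_, 0, ?_⟩
  · have : P₀.pt ∈ {x : X.left | x ≠ P₀.pt} := h ▸ Set.mem_univ _
    exact this rfl
  · haveI : Subsingleton (complexPointsCompl X {x | x ≠ P₀.pt}) := ⟨fun P Q ↦ Subtype.ext
      ((AlgPoints.eq_of_pt_eq (not_not.1 P.2)).trans (AlgPoints.eq_of_pt_eq (not_not.1 Q.2)).symm)⟩
    haveI := ModuleCat.subsingleton_of_isZero
      (singularCochainComplex.isZero_singularCohomology_of_subsingleton' (R := ℤ) (M := ℤ)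
        (X := complexPointsCompl X {x | x ≠ P₀.pt}) (n := 2 * p) (by omega))
    exact Subsingleton.elim _ _

/-! ## (b) Tightness: the modulus `m = 1` is free -/

/-- **C1 at `m = 1` holds trivially** (`Z = ∅`, `y = z|`): the content of C1 starts at `m = 2`
(and by coprime gluing on `X` irreducible only prime powers `m = ℓʳ` matter — positive remark for
the provers, not typed here). [cite: HatcherAT2002, §3.1] -/
theorem crux_at_modulus_one ⦃p : ℕ⦄ ⦃X : SchemeOver ℂ⦄ (_hp : 1 ≤ p)
    (hX : IsSmoothProjective (2 * p) X) (z : singularCohomology ℤ ℤ (ComplexPoints X) (2 * p)) :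
    ∃ Z : Set X.left, IsClosed Z ∧ Z ≠ Set.univ ∧
      ∃ y : singularCohomology ℤ ℤ (complexPointsCompl X Z) (2 * p),
        1 • y = singularCohomology.map ℤ ℤ
          (⟨Subtype.val, continuous_subtype_val⟩ : C(complexPointsCompl X Z, ComplexPoints X))
          (2 * p) z := by
  haveI := hX.geometricallyIrreducible
  haveI : IrreducibleSpace X.left :=
    AlgebraicGeometry.GeometricallyIrreducible.irreducibleSpace_of_subsingleton X.hom
  exact ⟨∅, isClosed_empty, fun h ↦ (Set.empty_ne_univ h).elim, _, one_smul _ _⟩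

end Summit.HodgeConjecture.HodgeConjecture.Cruxes.HodgeClassesGenericallyDivisible.Disproof

end
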